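import Literature.AlgebraicGeometry.Resolution.AlterationsNormalFormBlowupProofs
import HarnessLib

/-!
# `WildQuotients.SummitReduction` (stmt-ResolutionOfSingularities-16324), line `FramePerfect`, stub
# `stub_pair_ssOrbitBlowup` (B): formal normal crossings are normal crossings over a PERFECT field

Route `ResolutionOfSingularities/WildQuotients`, crux `SummitReduction`; helper file of the line
skeleton `Cruxes/SummitReduction/Lines/FramePerfect.lean` (v7), stub B (`stub_pair_ssOrbitBlowup` =
de Jong 1997, Prop. 5.11 ¶2–3 = de Jong 1996, 3.5 + 4.25–4.28 made `G`-equivariant). Stub B follows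
from an invariant of the orbit blow-up iteration with four obligations
(`ssOrbitBlowup_of_invariant`, LANDED); the invariant is de Jong 1997's coefficient-free,
equivariant Situation 4.25 (`DeJong1997.QuasiSplitNormalFormPair`, proposed to Literature,
p139488). This file discharges, DEF-FREE, the second half of the obligation `hzero` ("measure `0`
⇒ `Z` is a normal crossings divisor") at the generality of the line — over a PERFECT ground field
(the line's induction `pair_statementUpToDim` runs over `[PerfectField k]`) and at closed points
with ARBITRARY (finite) residue fields:

* `exists_etale_isSNCIdeal_of_formal_rsop` — the local algebra of the tree's
  Artin-approximation-free comparison (`exists_etale_isSNCIdeal_of_formal`,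
  `FormalBranchesLocal.lean`) with its one rationality-dependent hypothesis removed: instead of a
  ring isomorphism `Â ≅ k⟦X₁, …, X_d⟧` with coefficients in the GROUND field (which exists only if
  the residue field is `k`), only formal coordinates `x₁, …, x_d` generating `𝔪_Â` with
  `I Â = (x₁ ⋯ x_r)` are assumed — this is all the tree's proof uses (adapted proof, same steps:
  adapted minimal generators, dual derivations over the perfect `k`, Jacobian ideal of the double
  locus, its chart, étale splitting and descent);
* `exists_etale_isSNCIdeal_of_isSNCIdeal_map` — the same from local strict normal crossings data
  of `I Â` (`IsSNCIdeal`, the shape of 4.25 (i) in `QuasiSplitNormalFormPair`);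
* `exists_etale_isStrictNormalCrossingsAt_of_isSNCIdeal` — the pointwise scheme statement: at a
  point `x` of `X` (locally of finite type over the perfect `k`) with `𝒪_{X,x}` regular and
  `Î_Z ⊆ 𝒪̂_{X,x}` with local strict normal crossings data, some étale neighbourhood makes `Z`
  strict normal crossings at a point over `x` (the tree's
  `exists_etale_isStrictNormalCrossingsAt_of_formal_of_isAlgClosed`, adapted: `IsAlgClosed k` was
  used there only through `PerfectField k`);
* `isNormalCrossingsDivisor_of_isSNCIdeal_completedStalkIdeal` — **obligation (iv)**: for `X`
  locally of finite type over a perfect field, a closed `Z ⊆ X` along which `X` is regular and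
  whose completed ideal has local strict normal crossings data at every CLOSED point of `Z` is a
  normal crossings divisor (de Jong 1996, 2.4) — closed points suffice on the Jacobson `X`.

## Sources

* A. J. de Jong, *Families of curves and alterations*, Ann. Inst. Fourier 47 (1997), proof of
  Prop. 5.11, p. 619. [DeJong1997]
* A. J. de Jong, *Smoothness, semi-stability and alterations*, Publ. Math. IHÉS 83 (1996), 2.4
  (p. 55), 4.25 (i) and 4.28 (pp. 75–76). [DeJong1996]
* J. Kollár, *Lectures on Resolution of Singularities* (2007), Rem. 1.45. [Kollar2007]
-/

set_option linter.dupNamespace false -- the tree's summit namespace repeats `ResolutionOfSingularities`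

noncomputable section

open CategoryTheory CategoryTheory.Limits AlgebraicGeometry TopologicalSpace Topology IsLocalRing
  Scheme.IdealSheafData
open Literature.AlgebraicGeometry.Resolution

namespace Summit.ResolutionOfSingularities.ResolutionOfSingularities.Theorems

/-! ## Local algebra: formal coordinates instead of a `k`-rational formal chart -/

section Local

variable {A : Type} [CommRing A] [IsRegularLocalRing A]

/-- **Formal normal crossings at a smooth point are strict normal crossings in an étale
neighbourhood of the local ring — coordinate form.** Let `A` be a regular local ring of
dimension `d`, essentially of finite type and formally smooth over a perfect field `k`,
`1 ≤ r ≤ d`, `I ⊆ A` an ideal, and `x₁, …, x_d ∈ Â` generators of `𝔪_Â` (`Â` the `𝔪_A`-adic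
completion) with `I Â = (x₁ ⋯ x_r)`. Then there are an étale `A`-algebra `R'` and a prime `P`
of `R'` over `𝔪_A` with `A → κ(P)` onto such that `I R'_P` has local strict normal crossings
data. (The tree's `exists_etale_isSNCIdeal_of_formal` VERBATIM after its first step, which only
extracted such `xᵢ` from a ring isomorphism `Â ≅ k⟦X₁, …, X_d⟧`; no residue-field hypothesis.)
[cite: DeJong1996, 4.25 (i) and 2.4, pp. 75, 55] -/
theorem exists_etale_isSNCIdeal_of_formal_rsop (k : Type) [Field k] [PerfectField k] [Algebra k A]
    [Algebra.EssFiniteType k A] [Algebra.FormallySmooth k A] {d r : ℕ}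
    (hdimA : ringKrullDim A = d) (hr : 1 ≤ r) (hrd : r ≤ d) (I : Ideal A)
    (x : Fin d → AdicCompletion (maximalIdeal A) A)
    (hspan : Ideal.span (Set.range x) = maximalIdeal (AdicCompletion (maximalIdeal A) A))
    (hI : I.map (algebraMap A (AdicCompletion (maximalIdeal A) A)) =
      Ideal.span {branchProd x r}) :
    ∃ (R' : Type) (_ : CommRing R') (_ : Algebra A R') (_ : Algebra.Etale A R') (P : Ideal R')
      (_ : P.IsPrime) (_ : P.LiesOver (maximalIdeal A)),
      Function.Surjective (algebraMap A P.ResidueField) ∧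
        IsSNCIdeal (I.map (algebraMap A (Localization.AtPrime P))) := by
  -- adapted from `Literature.AlgebraicGeometry.Resolution.exists_etale_isSNCIdeal_of_formal`
  classical
  /- the completion `ι : A → Â` -/
  let ι := algebraMap A (AdicCompletion (maximalIdeal A) A)
  haveI : IsRegularLocalRing (AdicCompletion (maximalIdeal A) A) :=
    isRegularLocalRing_adicCompletion A
  have happrox : ∀ y : AdicCompletion (maximalIdeal A) A,
      ∃ a : A, y - ι a ∈ maximalIdeal (AdicCompletion (maximalIdeal A) A) :=
    exists_sub_algebraMap_mem_maximalIdeal_adicCompletion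
  have hdim : ringKrullDim (AdicCompletion (maximalIdeal A) A) = d := by
    rw [ringKrullDim_adicCompletion, hdimA]
  have hx : ∀ i, x i ∈ maximalIdeal (AdicCompletion (maximalIdeal A) A) := fun i =>
    hspan ▸ Ideal.subset_span ⟨i, rfl⟩
  have hli := linearIndependent_toCotangent_of_span_eq_maximalIdeal hdim x hspan
  haveI : IsDomain (AdicCompletion (maximalIdeal A) A) := isDomain_of_isRegularLocalRing _
  -- the formal coordinates are non-zero (they are minimal generators), so is their product
  have hx0 : ∀ i, x i ≠ 0 := by
    intro i h0
    have key := (linearIndependent_toCotangent_iff_forall_mem x hx).mp hli (Pi.single i 1) ?_ i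
    · rw [Pi.single_eq_same] at key
      exact (maximalIdeal.isMaximal (AdicCompletion (maximalIdeal A) A)).ne_top
        ((Ideal.eq_top_iff_one _).mpr key)
    · rw [Finset.sum_eq_single i (fun j _ hj => by rw [Pi.single_eq_of_ne hj, zero_mul])
        (fun h => (h (Finset.mem_univ i)).elim), Pi.single_eq_same, one_mul, h0]
      exact Ideal.zero_mem _
  have hπ0 : branchProd x r ≠ 0 := Finset.prod_ne_zero_iff.mpr fun i _ => hx0 i
  /- the equation `g` of the divisor -/
  obtain ⟨g, -, hgspan⟩ := SNCLocalDescent.exists_eq_span_singleton_of_map_eq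
    (B := AdicCompletion (maximalIdeal A) A) I hπ0 hI
  obtain ⟨w, hw⟩ := Ideal.span_singleton_eq_span_singleton.mp hgspan
  let v : (AdicCompletion (maximalIdeal A) A)ˣ := w⁻¹
  have hg : ι g = v * branchProd x r := by
    rw [← hw, mul_comm (ι g), ← mul_assoc, Units.inv_mul, one_mul]
  /- adapted coordinates and dual derivations -/
  obtain ⟨u, hu, huspan⟩ := exists_coord_adapted x hspan
  have hcard : Fintype.card (Fin d) = (maximalIdeal A).spanFinrank := by
    have h := IsRegularLocalRing.spanFinrank_maximalIdeal (R := A)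
    rw [hdimA] at h
    rw [Fintype.card_fin]
    exact_mod_cast h.symm
  obtain ⟨cs, hcs⟩ := exists_coordSystem_coord_eq_of_perfectField (k := k) u huspan hcard
  let D : Fin d → Derivation ℤ A A := fun i => (cs.deriv i).restrictScalars ℤ
  have hDu : ∀ i j, D i (u j) = if i = j then 1 else 0 := by
    intro i j
    change cs.deriv i (u j) = _
    rw [← hcs]
    split_ifs with h
    · subst h; exact cs.deriv_coord_self i
    · exact cs.deriv_coord_of_ne i j h
  let Dh : Fin d → Derivation ℤ (AdicCompletion (maximalIdeal A) A)
      (AdicCompletion (maximalIdeal A) A) := fun i => adicDerivation (D i)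
  have hcompat : ∀ i a, ι (D i a) = Dh i (ι a) := fun i a =>
    (adicDerivation_algebraMap (D i) a).symm
  /- the Jacobian ideal and the generic element -/
  let 𝔇 : Ideal A := doubleLocusIdealAlg D g
  let s : A := genericElement r D g
  let a : Fin d → AdicCompletion (maximalIdeal A) A := genericCoeff x r Dh v
  have h𝔇 := map_map_doubleLocusIdealAlg hcompat hDu hu hg
  have hs := mk_algebraMap_genericElement (r := r) hcompat hg
  have ha : ∀ j ∈ branchSet d r, IsUnit (a j) := fun j hj => isUnit_genericCoeff hcompat hDu hu hj
  /- the chart and its formal branch decomposition -/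
  let Φ := doubleLocusChartEquiv I x r hx hli a ha hI 𝔇 s h𝔇 hs
  haveI := finite_doubleLocusChart I x r hx hli a ha hI 𝔇 s h𝔇 hs
  /- étale splitting and descent -/
  exact exists_etale_isSNCIdeal_of_branchDecomposition happrox x hspan hdim hr hrd Φ I hI

/-- The range of an appended family is the union of the ranges. [folklore] -/
private theorem range_fin_append {α : Type*} {r e : ℕ} (x : Fin r → α) (y : Fin e → α) :
    Set.range (Fin.append x y) = Set.range x ∪ Set.range y := by
  ext a
  simp only [Set.mem_range, Set.mem_union]
  constructor
  · rintro ⟨i, rfl⟩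
    refine Fin.addCases (fun i => ?_) (fun i => ?_) i
    · exact Or.inl ⟨i, by rw [Fin.append_left]⟩
    · exact Or.inr ⟨i, by rw [Fin.append_right]⟩
  · rintro (⟨i, rfl⟩ | ⟨i, rfl⟩)
    · exact ⟨Fin.castAdd e i, by rw [Fin.append_left]⟩
    · exact ⟨Fin.natAdd r i, by rw [Fin.append_right]⟩

/-- The product over the first `r` indices of an appended family is the product of its first
part. [folklore] -/
private theorem branchProd_fin_append {P : Type*} [CommRing P] {r e : ℕ} (x : Fin r → P)
    (y : Fin e → P) : branchProd (Fin.append x y) r = ∏ i, x i := by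
  rw [branchProd, branchSet, Finset.prod_filter, Fin.prod_univ_add]
  have h1 : ∀ i : Fin r, (if ((Fin.castAdd e i : Fin (r + e)) : ℕ) < r then
      Fin.append x y (Fin.castAdd e i) else 1) = x i := fun i => by
    rw [if_pos (by simp), Fin.append_left]
  have h2 : ∀ i : Fin e, (if ((Fin.natAdd r i : Fin (r + e)) : ℕ) < r then
      Fin.append x y (Fin.natAdd r i) else 1) = 1 := fun i => by
    rw [if_neg (by simp)]
  simp_rw [h1, h2, Finset.prod_const_one, mul_one]

/-- **The same from local strict normal crossings data of `I Â`** (`IsSNCIdeal`: the completion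
`Â` regular with a regular system of parameters `x₁, …, x_r, y₁, …, y_e`, `r ≥ 1`, and
`I Â = (x₁ ⋯ x_r)` — the form of de Jong 1996, 4.25 (i) at a closed point with arbitrary
residue field): an étale `A`-algebra `R'` and a prime `P` over `𝔪_A` with trivial residue
extension such that `I R'_P` has local strict normal crossings data.
[cite: DeJong1996, 4.25 (i) and 2.4, pp. 75, 55] -/
theorem exists_etale_isSNCIdeal_of_isSNCIdeal_map (k : Type) [Field k] [PerfectField k]
    [Algebra k A] [Algebra.EssFiniteType k A] [Algebra.FormallySmooth k A] (I : Ideal A)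
    (hformal : IsSNCIdeal (I.map (algebraMap A (AdicCompletion (maximalIdeal A) A)))) :
    ∃ (R' : Type) (_ : CommRing R') (_ : Algebra A R') (_ : Algebra.Etale A R') (P : Ideal R')
      (_ : P.IsPrime) (_ : P.LiesOver (maximalIdeal A)),
      Function.Surjective (algebraMap A P.ResidueField) ∧
        IsSNCIdeal (I.map (algebraMap A (Localization.AtPrime P))) := by
  obtain ⟨-, r, e, xs, ys, hr, hdim, hspan, hI⟩ := hformal
  have hdimA : ringKrullDim A = (r + e : ℕ) := by rw [← ringKrullDim_adicCompletion, hdim]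
  refine exists_etale_isSNCIdeal_of_formal_rsop k hdimA hr (Nat.le_add_right r e) I
    (Fin.append xs ys) ?_ ?_
  · rw [range_fin_append, hspan]
  · rw [branchProd_fin_append, hI]

end Local

/-! ## The pointwise scheme statement -/

/-- **The pointwise theorem over a perfect field with arbitrary residue field**: at a point `x`
of `X` (locally of finite type over the perfect field `k`) with `𝒪_{X,x}` regular and such that
the completed ideal `Î_Z = I(Z)_x 𝒪̂_{X,x}` of the closed `Z` has local strict normal crossings
data in `𝒪̂_{X,x}`, there are an étale `g : U → X` and `u ↦ x` such that `g⁻¹ Z` satisfies the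
strict normal crossings condition at `u`. Proof as for the tree's
`exists_etale_isStrictNormalCrossingsAt_of_formal_of_isAlgClosed` (whose algebraic closedness
served only to make `k` perfect): `A = 𝒪_{X,x}` is essentially of finite type and formally smooth
over `k` (`essFiniteType_formallySmooth_stalk`), the local algebra
(`exists_etale_isSNCIdeal_of_isSNCIdeal_map`) gives an étale `A`-algebra, which spreads over an
affine chart (`exists_etale_spread`) to the étale neighbourhood `Spec E → Spec Γ(X, W) → X`.
[cite: DeJong1996, 2.4 and 4.25 (i), pp. 55, 75] -/
theorem exists_etale_isStrictNormalCrossingsAt_of_isSNCIdeal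
    {k : Type} [Field k] [PerfectField k] {X : Scheme.{0}} (f : X ⟶ Spec (.of k))
    [LocallyOfFiniteType f] {Z : Set X} (hZ : IsClosed Z) {x : X}
    [IsRegularLocalRing (X.presheaf.stalk x)]
    (hformal : IsSNCIdeal ((stalkIdeal (vanishingIdeal ⟨Z, hZ⟩) x).map
      (algebraMap (X.presheaf.stalk x)
        (AdicCompletion (maximalIdeal (X.presheaf.stalk x)) (X.presheaf.stalk x))))) :
    ∃ (U : Scheme.{0}) (g : U ⟶ X), Etale g ∧ ∃ u : U, g u = x ∧
      IsStrictNormalCrossingsAt U (g ⁻¹' Z) u := by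
  -- adapted from `exists_etale_isStrictNormalCrossingsAt_of_formal_of_isAlgClosed`
  classical
  have hreg : IsRegularLocalRing (X.presheaf.stalk x) := ‹_›
  haveI : IsLocallyNoetherian X := LocallyOfFiniteType.isLocallyNoetherian f
  /- (1) an affine chart `W ∋ x` and the `k`-algebra `A = 𝒪_{X,x}` -/
  obtain ⟨W, hW, hxW, -⟩ :=
    exists_isAffineOpen_mem_and_subset (X := X) (x := x) (U := ⊤) trivial
  letI := sectionsAlgebraOfOver f (W := W)
  letI algA : Algebra Γ(X, W) (X.presheaf.stalk x) :=
    TopCat.Presheaf.algebra_section_stalk X.presheaf (⟨x, hxW⟩ : W)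
  letI : Algebra k (X.presheaf.stalk x) :=
    ((algebraMap Γ(X, W) (X.presheaf.stalk x)).comp (algebraMap k Γ(X, W))).toAlgebra
  haveI : IsScalarTower k Γ(X, W) (X.presheaf.stalk x) := IsScalarTower.of_algebraMap_eq fun _ => rfl
  haveI hlocA := hW.isLocalization_stalk ⟨x, hxW⟩
  obtain ⟨hEss, hSm⟩ := essFiniteType_formallySmooth_stalk f hW hxW hreg
  haveI := hEss
  haveI := hSm
  /- (2) the ideal of `Z` at `x` -/
  let I : Ideal (X.presheaf.stalk x) := stalkIdeal (vanishingIdeal ⟨Z, hZ⟩) x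
  /- (3) the local algebra: an étale `A`-algebra with strict normal crossings at a prime -/
  obtain ⟨R', _, _, _, P, _, _, -, hsnc⟩ :=
    exists_etale_isSNCIdeal_of_isSNCIdeal_map k I hformal
  /- (4) spread it to an étale algebra over `Γ(X, W)` -/
  letI : Algebra Γ(X, W) R' :=
    ((algebraMap (X.presheaf.stalk x) R').comp (algebraMap Γ(X, W) (X.presheaf.stalk x))).toAlgebra
  haveI : IsScalarTower Γ(X, W) (X.presheaf.stalk x) R' := IsScalarTower.of_algebraMap_eq fun _ => rfl
  obtain ⟨E, _, _, _, Q, _, hQ, ⟨ι⟩⟩ :=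
    exists_etale_spread (hW.primeIdealOf ⟨x, hxW⟩).asIdeal.primeCompl (A := X.presheaf.stalk x) P
  -- `Q` lies over the prime of `x`
  have hQx : Q.under Γ(X, W) = (hW.primeIdealOf ⟨x, hxW⟩).asIdeal := by
    rw [hQ, ← Ideal.under_under (B := X.presheaf.stalk x), ← P.over_def (maximalIdeal _)]
    exact IsLocalization.AtPrime.under_maximalIdeal (X.presheaf.stalk x) _
  /- (5) the étale neighbourhood `g : Spec E → Spec Γ(X, W) → X` and its point -/
  let φ : Γ(X, W) ⟶ CommRingCat.of E := CommRingCat.ofHom (algebraMap Γ(X, W) E)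
  let g : Spec (.of E) ⟶ X := Spec.map φ ≫ hW.fromSpec
  let u : PrimeSpectrum (CommRingCat.of E) := ⟨Q, inferInstance⟩
  have hgu₀ : Spec.map φ u = hW.primeIdealOf ⟨x, hxW⟩ := PrimeSpectrum.ext hQx
  have hgu : g u = x := by
    change hW.fromSpec (Spec.map φ u) = x
    rw [hgu₀]
    exact hW.fromSpec_primeIdealOf ⟨x, hxW⟩
  -- make `x = g u` definitional
  subst hgu
  haveI : Etale (Spec.map φ) :=
    (HasRingHomProperty.Spec_iff (P := @Etale)).mpr (RingHom.etale_algebraMap.mpr ‹Algebra.Etale Γ(X, W) E›)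
  haveI : Etale g := inferInstance
  refine ⟨Spec (.of E), g, inferInstance, u, rfl, ?_⟩
  /- (6) the stalk map at `u` is `A → R'_P ≅ E_Q = 𝒪_{Spec E, u}` -/
  have hle : (⊤ : (Spec (CommRingCat.of E)).Opens) ≤ g ⁻¹ᵁ W := fun y _ => by
    change hW.fromSpec (Spec.map φ y) ∈ (W : Set X)
    rw [← hW.range_fromSpec]
    exact ⟨_, rfl⟩
  haveI : IsScalarTower Γ(X, W) (X.presheaf.stalk (g u)) (Localization.AtPrime P) :=
    IsScalarTower.of_algebraMap_eq fun a => by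
      rw [IsScalarTower.algebraMap_apply (X.presheaf.stalk (g u)) R' (Localization.AtPrime P),
        IsScalarTower.algebraMap_apply Γ(X, W) R' (Localization.AtPrime P),
        IsScalarTower.algebraMap_apply Γ(X, W) (X.presheaf.stalk (g u)) R']
  let Θ : Localization.AtPrime P ≃+* (Spec (CommRingCat.of E)).presheaf.stalk u :=
    ι.symm.toRingEquiv.trans (Spec.stalkIso (.of E) u).commRingCatIsoToRingEquiv.symm
  have hΘ : (g.stalkMap u).hom =
      (Θ : Localization.AtPrime P →+* (Spec (CommRingCat.of E)).presheaf.stalk u).comp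
        (algebraMap (X.presheaf.stalk (g u)) (Localization.AtPrime P)) := by
    refine IsLocalization.ringHom_ext (hW.primeIdealOf ⟨g u, hxW⟩).asIdeal.primeCompl
      (RingHom.ext fun a => ?_)
    change (g.stalkMap u).hom ((X.presheaf.germ W (g u) hxW).hom a) =
      Θ (algebraMap (X.presheaf.stalk (g u)) (Localization.AtPrime P)
        ((X.presheaf.germ W (g u) hxW).hom a))
    -- left: through `appLE`
    have h1 : (g.stalkMap u).hom ((X.presheaf.germ W (g u) hxW).hom a) =
        ((Spec (CommRingCat.of E)).presheaf.germ ⊤ u trivial).hom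
          ((Scheme.ΓSpecIso (.of E)).inv.hom (algebraMap Γ(X, W) E a)) := by
      rw [← germ_appLE_eq_stalkMap_germ g W ⊤ u trivial hle a]
      change _ = ((Spec (CommRingCat.of E)).presheaf.germ ⊤ u trivial).hom
        ((φ ≫ (Scheme.ΓSpecIso (.of E)).inv).hom a)
      rw [← appLE_SpecMap_comp_fromSpec hW φ hle]
    -- right: through `E_Q`
    have h2 : Θ (algebraMap (X.presheaf.stalk (g u)) (Localization.AtPrime P)
        ((X.presheaf.germ W (g u) hxW).hom a)) =
        ((Spec (CommRingCat.of E)).presheaf.germ ⊤ u trivial).hom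
          ((Scheme.ΓSpecIso (.of E)).inv.hom (algebraMap Γ(X, W) E a)) := by
      have h3 : algebraMap (X.presheaf.stalk (g u)) (Localization.AtPrime P)
          ((X.presheaf.germ W (g u) hxW).hom a) = algebraMap Γ(X, W) (Localization.AtPrime P) a :=
        (IsScalarTower.algebraMap_apply Γ(X, W) (X.presheaf.stalk (g u)) (Localization.AtPrime P) a).symm
      rw [h3]
      change (Spec.stalkIso (.of E) u).inv.hom (ι.symm (algebraMap Γ(X, W) (Localization.AtPrime P) a)) = _
      rw [AlgEquiv.commutes, IsScalarTower.algebraMap_apply Γ(X, W) E (Localization.AtPrime Q)]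
      have hinv := congrArg (fun ψ => ψ.hom (algebraMap Γ(X, W) E a))
        (Spec.algebraMap_stalkIso_inv (R := CommRingCat.of E) (x := u))
      simpa only [CommRingCat.hom_comp, RingHom.comp_apply, CommRingCat.hom_ofHom] using hinv
    rw [h1, h2]
  /- (7) the ideal of `g⁻¹ Z` at `u` is the extension of the ideal of `Z` at `g u` -/
  unfold IsStrictNormalCrossingsAt
  letI algB := TopCat.Presheaf.algebra_section_stalk (Spec (CommRingCat.of E)).presheaf
    (⟨u, trivial⟩ : (⊤ : (Spec (CommRingCat.of E)).Opens))
  haveI hlocB := (isAffineOpen_top (Spec (CommRingCat.of E))).isLocalization_stalk ⟨u, trivial⟩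
  have hcl : (⟨closure (g ⁻¹' Z), isClosed_closure⟩ : Closeds (Spec (CommRingCat.of E))) =
      ⟨g ⁻¹' Z, hZ.preimage g.continuous⟩ :=
    Closeds.ext (hZ.preimage g.continuous).closure_eq
  have hrad : ∀ J : Ideal Γ(Spec (CommRingCat.of E), ⊤),
      (J.radical).map ((Spec (CommRingCat.of E)).presheaf.germ ⊤ u trivial).hom =
        (J.map ((Spec (CommRingCat.of E)).presheaf.germ ⊤ u trivial).hom).radical := fun J =>
    IsLocalization.map_radical
      ((isAffineOpen_top (Spec (CommRingCat.of E))).primeIdealOf ⟨u, trivial⟩).asIdeal.primeCompl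
      ((Spec (CommRingCat.of E)).presheaf.stalk u) J
  rw [hcl, vanishingIdeal_preimage_eq_radical_comap g hZ,
    stalkIdeal_eq_map_germ _ ⟨⊤, isAffineOpen_top _⟩ trivial, radical_ideal, hrad,
    ← stalkIdeal_eq_map_germ _ ⟨⊤, isAffineOpen_top _⟩ trivial,
    Scheme.IdealSheafData.comap_comp, stalkIdeal_comap (Spec.map φ),
    stalkIdeal_comap_of_isOpenImmersion hW.fromSpec, Ideal.map_map, ← CommRingCat.hom_comp,
    ← Scheme.Hom.stalkMap_comp]
  change IsSNCIdeal ((I.map (g.stalkMap u).hom).radical)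
  have key : IsSNCIdeal ((I.map (algebraMap _ (Localization.AtPrime P))).map
      (Θ : Localization.AtPrime P →+* (Spec (CommRingCat.of E)).presheaf.stalk u)) :=
    IsSNCIdeal.of_ringEquiv Θ hsnc
  rw [hΘ, ← Ideal.map_map, key.radical_eq]
  exact key

/-! ## Obligation (iv): formal normal crossings at the closed points ⇒ normal crossings -/

/-- **Formal normal crossings are normal crossings, over a perfect field** (de Jong 1996, the
equivalence used silently between 4.25 (i) and 4.28/2.4; Kollár 2007, Rem. 1.45; here for
ARBITRARY residue fields at the closed points, as needed for de Jong 1997, Prop. 5.11): let `X`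
be locally of finite type over a perfect field `k` and `Z ⊆ X` closed such that at every closed
point `p ∈ Z` the local ring `𝒪_{X,p}` is regular and the completed ideal of (the reduced
structure on) `Z` in `𝒪̂_{X,p}` (`completedStalkIdeal`, any affine open `U ∋ p`) has local strict
normal crossings data (`IsSNCIdeal`). Then `Z` is a normal crossings divisor on `X`
(`IsNormalCrossingsDivisor`, de Jong 1996, 2.4). Proof: the pointwise theorem gives an étale
neighbourhood with strict normal crossings at a point over `p`, hence on a neighbourhood
(`IsStrictNormalCrossingsAt.exists_isStrictNormalCrossingsDivisor_preimage`); closed points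
suffice on the Jacobson scheme `X` (`IsNormalCrossingsDivisor.of_forall_closedPoints_exists_etale`).
This is the second half of the obligation `hzero` of `ssOrbitBlowup_of_invariant` for the
invariant `DeJong1997.QuasiSplitNormalFormPair` (its field 4.25 (i)).
[cite: DeJong1996, 2.4 and 4.25 (i), 4.28, pp. 55, 75–76] -/
theorem isNormalCrossingsDivisor_of_isSNCIdeal_completedStalkIdeal (k : Type) [Field k]
    [PerfectField k] (X : Scheme.{0}) (f : X ⟶ Spec (.of k)) [LocallyOfFiniteType f] (Z : Set X)
    (hZ : IsClosed Z)
    (hreg : ∀ p ∈ Z, IsClosed ({p} : Set X) → IsRegularLocalRing (X.presheaf.stalk p))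
    (hformal : ∀ p : X, IsClosed ({p} : Set X) → ∀ [IsRegularLocalRing (X.presheaf.stalk p)],
      p ∈ Z → ∀ (U : X.affineOpens) (hU : p ∈ (U : X.Opens)),
        IsSNCIdeal (completedStalkIdeal (Scheme.IdealSheafData.vanishingIdeal ⟨Z, hZ⟩) p U hU)) :
    IsNormalCrossingsDivisor X Z := by
  haveI : IsLocallyNoetherian X := LocallyOfFiniteType.isLocallyNoetherian f
  haveI : JacobsonSpace X := LocallyOfFiniteType.jacobsonSpace f
  refine IsNormalCrossingsDivisor.of_forall_closedPoints_exists_etale hZ fun p hpZ hpcl => ?_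
  haveI : IsRegularLocalRing (X.presheaf.stalk p) := hreg p hpZ hpcl
  -- the formal condition at the closed point `p ∈ Z`, on an affine open neighbourhood
  obtain ⟨W, hW, hpW, -⟩ :=
    exists_isAffineOpen_mem_and_subset (X := X) (x := p) (U := ⊤) trivial
  have h := hformal p hpcl hpZ ⟨W, hW⟩ hpW
  have hI : completedStalkIdeal (vanishingIdeal ⟨Z, hZ⟩) p ⟨W, hW⟩ hpW =
      (stalkIdeal (vanishingIdeal ⟨Z, hZ⟩) p).map (algebraMap (X.presheaf.stalk p)
        (AdicCompletion (maximalIdeal (X.presheaf.stalk p)) (X.presheaf.stalk p))) := by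
    rw [stalkIdeal_eq_map_germ _ ⟨W, hW⟩ hpW]
    rfl
  rw [hI] at h
  obtain ⟨U, g, hg, u, hgu, hsnc⟩ := exists_etale_isStrictNormalCrossingsAt_of_isSNCIdeal f hZ h
  haveI := hg
  -- spread to an open neighbourhood of `u`
  obtain ⟨V, huV, hV⟩ := hsnc.exists_isStrictNormalCrossingsDivisor_preimage (g ≫ f)
    (hZ.preimage g.continuous)
  refine ⟨V, V.ι ≫ g, inferInstance, ⟨⟨u, huV⟩, ?_⟩, ?_⟩
  · rw [← hgu]
    rfl
  · rwa [show ((V.ι ≫ g) ⁻¹' Z : Set V) = V.ι ⁻¹' (g ⁻¹' Z) by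
      ext v
      simp only [Set.mem_preimage, Scheme.Hom.comp_apply]]

end Summit.ResolutionOfSingularities.ResolutionOfSingularities.Theorems

end
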